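import Literature.NumberTheory.EllipticCurves.LatticeEndomorphismOfCurve
import Literature.NumberTheory.EllipticCurves.ComplexMultiplicationHasCMProofs
import Literature.NumberTheory.EllipticCurves.ComplexMultiplicationHasCMLeavesProofs
import HarnessLib

/-!
# `End(E) ≠ ℤ ⟹ End(Λ) ≠ ℤ`: discharge of `periodPair_hasCM_of_hasCM`

Topic `NumberTheory/EllipticCurves`; a proofs-only file (theorems only, no definitions, no named
facts).  It **discharges the named fact**
`Literature.NumberTheory.EllipticCurves.periodPair_hasCM_of_hasCM`
(`ComplexMultiplicationJInvariantProofs.lean`; Silverman, *AEC*, Thm. VI.5.3 with VI.4.1(b) and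
VI.6.1: if `E/ℚ` has (geometric) complex multiplication then every period lattice `Λ` of `E/ℂ`
— `g₂(Λ) = c₄/12`, `g₃(Λ) = c₆/216` — has complex multiplication), one of the five leaves of
the Coates–Wiles fact `finite_point_of_hasCM_of_L_one_ne_zero` recorded in
`ComplexMultiplicationHasCMLeavesProofs.lean`, and re-assembles that fact from the remaining four.

* `periodPair_hasCM_of_hasCM_holds` — the discharge.  Proof: `W` and its short model
  `E₀ = (0, 0, 0, −c₄/48, −c₆/864)` over `ℚ` have the same `j`, so `E₀` has CM
  (`WeierstrassCurve.hasCM_iff_of_j_eq`), and `E₀ ⊗ ℂ` *is* the curve `E_Λ : y² = x³ − (g₂/4)x − g₃/4`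
  of the tree's `ComplexTorus.lean`; a non-scalar element of `End_{ℚ̄}(E₀)` is an algebraic additive
  map of `E₀(ℚ̄)` (`WeierstrassCurve.mem_geomEndRing_iff_holds`), i.e. a rational map
  `(x, y) ↦ (P₁/Q₁, P₂/Q₂)` off a finite set; an embedding `ι : ℚ̄ → ℂ` (`IsAlgClosed.lift`)
  carries `E₀(ℚ̄)` injectively into `E_Λ(ℂ)` (`WeierstrassCurve.Affine.Point.map`) onto a subgroup
  containing all torsion (both `n`-torsion groups have `n²` elements,
  `WeierstrassCurve.card_torsionBy_eq_sq` over `ℚ̄` and over `ℂ`), and the analytic theorem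
  `PeriodPair.hasCM_of_curve_endomorphism` (`LatticeEndomorphismOfCurve.lean`: local holomorphic
  lifts through `z ↦ (℘(z), ℘'(z)/2)` are affine, `z ↦ αz + β`, with `αΛ ⊆ Λ` and `α ∉ ℤ`)
  concludes.
* `j_mem_cmJInvariants_of_hasCM_of_three_facts`,
  `finite_point_of_hasCM_of_L_one_ne_zero_of_four_leaves` (and `…_of_four_leaves_of_two`),
  `bsdRankFormula_of_hasCM_of_L_one_ne_zero_of_four_leaves` — the assemblies of
  `ComplexMultiplicationHasCMLeavesProofs.lean` with the leaf `periodPair_hasCM_of_hasCM`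
  discharged: the trust base of `finite_point_of_hasCM_of_L_one_ne_zero` is now
  `CoatesWiles1977_L_one_div_period_mem_prime` (the `𝔭`-adic core of Coates–Wiles),
  `singularModuli_classNumberOne` (rows `−67, −163` of Cox's table (12.20)),
  `irreducible_classPolynomial` (the class equation) and
  `mem_classNumberOneDiscrs_of_classNumber_eq_one` (Heegner–Baker–Stark for orders).

## References

* J. H. Silverman, *The Arithmetic of Elliptic Curves*, 2nd ed., GTM 106, Springer 2009:
  Thm. VI.4.1(b), Thm. VI.5.3 and the display after Prop. VI.5.4 (`End(E) ≅ {α : αΛ ⊆ Λ}`),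
  Thm. VI.6.1 (Lefschetz principle), III.1 (short models), App. C §11 and §16.
  [SilvermanAEC2009]
* J. Coates, A. Wiles, *On the conjecture of Birch and Swinnerton-Dyer*, Invent. Math. 39 (1977),
  223–251, Thm. 1. [CoatesWiles1977]
-/

noncomputable section

open scoped Classical

namespace Literature.NumberTheory.EllipticCurves

open WeierstrassCurve PeriodPair

/-- **`periodPair_hasCM_of_hasCM` holds** (Silverman, *AEC*, VI.5.3 with VI.4.1(b): an elliptic
curve `E/ℚ` with geometric complex multiplication has a period lattice with complex
multiplication).  Proof: replace `W` by its short model `E₀ = (0, 0, 0, −c₄/48, −c₆/864)` over `ℚ`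
(same `j`, so `E₀` has CM by `hasCM_iff_of_j_eq`; `E₀ ⊗ ℂ` is literally the curve `E_Λ` of the
Néron lattice `Λ`); a non-scalar element of `End_{ℚ̄}(E₀)` is an algebraic additive map
(`mem_geomEndRing_iff_holds`), which an embedding `ℚ̄ ↪ ℂ` (`IsAlgClosed.lift`) transports to the
data of `PeriodPair.hasCM_of_curve_endomorphism` — the torsion of `E_Λ(ℂ)` lies in the image of
`E₀(ℚ̄)` because both `n`-torsion groups have `n²` elements (`card_torsionBy_eq_sq`).
[cite: SilvermanAEC2009, Thm. VI.4.1(b) and Thm. VI.5.3] -/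
theorem periodPair_hasCM_of_hasCM_holds : periodPair_hasCM_of_hasCM := by
  intro W _ L hL hCM
  -- Step 1: the short model `E₀` over `ℚ`, with `E₀ ⊗ ℂ = E_Λ`
  set E₀ : WeierstrassCurve ℚ := ⟨0, 0, 0, -W.c₄ / 48, -W.c₆ / 864⟩ with hE₀def
  have hg₂ : L.g₂ = (W.c₄ : ℂ) / 12 := by
    rw [hL.1]; simp [WeierstrassCurve.baseChange, WeierstrassCurve.map_c₄]
  have hg₃ : L.g₃ = (W.c₆ : ℂ) / 216 := by
    rw [hL.2]; simp [WeierstrassCurve.baseChange, WeierstrassCurve.map_c₆]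
  have hE₀ : E₀.baseChange ℂ = L.curve := by
    rw [PeriodPair.curve, hg₂, hg₃]
    ext
    · simp [hE₀def, WeierstrassCurve.baseChange]
    · simp [hE₀def, WeierstrassCurve.baseChange]
    · simp [hE₀def, WeierstrassCurve.baseChange]
    · simp only [hE₀def, WeierstrassCurve.baseChange, WeierstrassCurve.map_a₄, eq_ratCast]
      push_cast
      ring
    · simp only [hE₀def, WeierstrassCurve.baseChange, WeierstrassCurve.map_a₆, eq_ratCast]
      push_cast
      ring
  have hc₄ : E₀.c₄ = W.c₄ := by
    simp only [hE₀def, WeierstrassCurve.c₄, WeierstrassCurve.b₂, WeierstrassCurve.b₄]; ring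
  have hc₆ : E₀.c₆ = W.c₆ := by
    simp only [hE₀def, WeierstrassCurve.c₆, WeierstrassCurve.b₂, WeierstrassCurve.b₄,
      WeierstrassCurve.b₆]; ring
  have hΔ : E₀.Δ = W.Δ := by
    have h1 := E₀.c_relation
    have h2 := W.c_relation
    rw [hc₄, hc₆, ← h2] at h1
    exact mul_left_cancel₀ (by norm_num) h1
  haveI hE₀ell : E₀.IsElliptic := by
    rw [WeierstrassCurve.isElliptic_iff, hΔ]; exact W.isUnit_Δ
  have hj : E₀.j = W.j := by
    rw [WeierstrassCurve.j, WeierstrassCurve.j, Units.val_inv_eq_inv_val,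
      Units.val_inv_eq_inv_val, WeierstrassCurve.coe_Δ', WeierstrassCurve.coe_Δ', hΔ, hc₄]
  have hCM₀ : E₀.HasCM := (hasCM_iff_of_j_eq hj).2 hCM
  -- Step 2: a non-scalar algebraic endomorphism of `E₀(ℚ̄)`
  obtain ⟨φ, hφ, hn⟩ := hCM₀
  have hφ0 : φ ≠ 0 := fun h0 ↦ hn 0 (by rw [h0, Int.cast_zero])
  have halg : IsAlgebraicOn E₀ E₀ φ :=
    ((mem_geomEndRing_iff_holds (W := E₀) φ).1 hφ).resolve_left hφ0
  obtain ⟨P₁, Q₁, P₂, Q₂, hfin⟩ := halg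
  -- Step 3: transport along an embedding `ι : ℚ̄ → ℂ`
  set ι : AlgebraicClosure ℚ →ₐ[ℚ] ℂ :=
    (@IsAlgClosed.lift ℂ _ _ ℚ _ _ (AlgebraicClosure ℚ) _ _ (AlgebraicClosure.instAlgebra ℚ) _ _ _
      (AlgebraicClosure.isAlgebraic ℚ)) with hι
  set f : E₀.geomPoints →+ (E₀.baseChange ℂ).toAffine.Point :=
    WeierstrassCurve.Affine.Point.map (W' := E₀) ι with hf
  have hfinj : Function.Injective f := WeierstrassCurve.Affine.Point.map_injective (W' := E₀) ι
  set ιr : AlgebraicClosure ℚ →+* ℂ := (ι : AlgebraicClosure ℚ →+* ℂ) with hιr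
  have hιr_apply : ∀ a, ιr a = ι a := fun a ↦ rfl
  have heval : ∀ (P : MvPolynomial (Fin 2) (AlgebraicClosure ℚ)) (x y : AlgebraicClosure ℚ),
      MvPolynomial.eval ![ι x, ι y] (MvPolynomial.map ιr P) = ι (MvPolynomial.eval ![x, y] P) := by
    intro P x y
    have hv : (⇑ιr) ∘ ![x, y] = ![ι x, ι y] := by
      funext i
      fin_cases i <;> rfl
    rw [← hιr_apply (MvPolynomial.eval ![x, y] P), MvPolynomial.map_eval ιr ![x, y] P, hv]
  set p₁ := MvPolynomial.map ιr P₁ with hp₁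
  set q₁ := MvPolynomial.map ιr Q₁ with hq₁
  set p₂ := MvPolynomial.map ιr P₂ with hp₂
  set q₂ := MvPolynomial.map ιr Q₂ with hq₂
  -- the rational description survives the transport
  have halg' : {m : E₀.geomPoints | ¬ ∃ (x y : ℂ) (h : (E₀.baseChange ℂ).toAffine.Nonsingular x y),
      f m = .some x y h ∧ MvPolynomial.eval ![x, y] q₁ ≠ 0 ∧ MvPolynomial.eval ![x, y] q₂ ≠ 0 ∧
      ∃ h' : (E₀.baseChange ℂ).toAffine.Nonsingular
          (MvPolynomial.eval ![x, y] p₁ / MvPolynomial.eval ![x, y] q₁)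
          (MvPolynomial.eval ![x, y] p₂ / MvPolynomial.eval ![x, y] q₂),
        f (φ m) = .some _ _ h'}.Finite := by
    refine hfin.subset fun m hm hagree ↦ hm ?_
    obtain ⟨x, y, h, hPm, hQ₁, hQ₂, h', hφP⟩ := hagree
    have hns : (E₀.baseChange ℂ).toAffine.Nonsingular (ι x) (ι y) :=
      (E₀.toAffine.baseChange_nonsingular ι.injective x y).mpr h
    have hns' := (E₀.toAffine.baseChange_nonsingular ι.injective _ _).mpr h'
    have hfm : f m = .some (ι x) (ι y) hns := by
      rw [hPm]; exact WeierstrassCurve.Affine.Point.map_some ι h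
    have hfφ : f (φ m) = .some (ι (MvPolynomial.eval ![x, y] P₁ / MvPolynomial.eval ![x, y] Q₁))
        (ι (MvPolynomial.eval ![x, y] P₂ / MvPolynomial.eval ![x, y] Q₂)) hns' := by
      rw [hφP]; exact WeierstrassCurve.Affine.Point.map_some ι h'
    obtain ⟨h'', he⟩ := UnivEC.some_eq_some_of_eq
      (x' := MvPolynomial.eval ![ι x, ι y] p₁ / MvPolynomial.eval ![ι x, ι y] q₁)
      (y' := MvPolynomial.eval ![ι x, ι y] p₂ / MvPolynomial.eval ![ι x, ι y] q₂)
      (by rw [map_div₀, heval, heval]) (by rw [map_div₀, heval, heval]) hns'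
    refine ⟨ι x, ι y, hns, hfm, ?_, ?_, h'', hfφ.trans he⟩
    · rw [heval]; exact (map_ne_zero ι).2 hQ₁
    · rw [heval]; exact (map_ne_zero ι).2 hQ₂
  -- all torsion of `E₀(ℂ)` comes from `E₀(ℚ̄)`: both `n`-torsion groups have `n²` elements
  have htors : ∀ n : ℕ, 0 < n → ∀ P : (E₀.baseChange ℂ).toAffine.Point, n • P = 0 →
      P ∈ f.range := by
    intro n hn P hP
    have hn' : (n : ℤ) ≠ 0 := by exact_mod_cast hn.ne'
    have h1 : Nat.card (AddSubgroup.torsionBy E₀.geomPoints (n : ℤ)) = n ^ 2 := by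
      rw [natCard_torsionBy_geomPoints (W := E₀) hn', Int.natAbs_natCast]
    have h2 : Nat.card (AddSubgroup.torsionBy (E₀.baseChange ℂ).toAffine.Point (n : ℤ)) = n ^ 2 :=
      WeierstrassCurve.card_torsionBy_eq_sq (E := E₀.baseChange ℂ) (by exact_mod_cast hn.ne')
    set T₁ : Set E₀.geomPoints :=
      (AddSubgroup.torsionBy E₀.geomPoints (n : ℤ) : Set E₀.geomPoints) with hT₁
    set T₂ : Set (E₀.baseChange ℂ).toAffine.Point :=
      (AddSubgroup.torsionBy (E₀.baseChange ℂ).toAffine.Point (n : ℤ) :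
        Set (E₀.baseChange ℂ).toAffine.Point) with hT₂
    have hsub : f '' T₁ ⊆ T₂ := by
      rintro _ ⟨m, hm, rfl⟩
      simp only [hT₁, hT₂, SetLike.mem_coe, AddSubgroup.torsionBy.nsmul_iff] at hm ⊢
      rw [← map_nsmul, hm, map_zero]
    have hT₂fin : T₂.Finite := by
      have : Finite (AddSubgroup.torsionBy (E₀.baseChange ℂ).toAffine.Point (n : ℤ)) :=
        Nat.finite_of_card_ne_zero (by rw [h2]; exact pow_ne_zero 2 hn.ne')
      exact Set.toFinite _
    have hcard : T₂.ncard ≤ (f '' T₁).ncard := by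
      rw [Set.ncard_image_of_injective _ hfinj, ← Nat.card_coe_set_eq,
        ← Nat.card_coe_set_eq]
      exact (h2.trans h1.symm).le
    have heq : f '' T₁ = T₂ := Set.eq_of_subset_of_ncard_le hsub hcard hT₂fin
    have hP' : P ∈ T₂ := by
      simpa only [hT₂, SetLike.mem_coe, AddSubgroup.torsionBy.nsmul_iff] using hP
    rw [← heq] at hP'
    obtain ⟨m, -, hm⟩ := hP'
    exact ⟨m, hm⟩
  -- `φ` is not `[n]`
  have hne : ∀ n : ℤ, ∃ m, φ m ≠ n • m := by
    intro n
    by_contra h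
    push Not at h
    exact hn n (AddMonoid.End.ext_iff.2 fun m ↦ (h m).trans (AddMonoid.End.intCast_apply n m).symm)
  exact L.hasCM_of_curve_endomorphism (M := E₀.geomPoints)
    (φ : E₀.geomPoints →+ E₀.geomPoints) hE₀ f hfinj p₁ q₁ p₂ q₂ halg' htors hne


/-! ### Re-assembly: `finite_point_of_hasCM_of_L_one_ne_zero` from four leaves -/

open Literature.NumberTheory.QuadraticFields.BinaryQuadraticForm

/-- **`j_mem_cmJInvariants_of_hasCM` from three named facts** (the bridge
`periodPair_hasCM_of_hasCM` being proved): the class equation `irreducible_classPolynomial`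
(Cox Prop. 13.2), Heegner–Baker–Stark for orders (`mem_classNumberOneDiscrs_of_classNumber_eq_one`,
Cox Thm. 7.30(ii)) and the nine maximal singular moduli `singularModuli_classNumberOne` (Cox table
(12.20)). [cite: SilvermanAEC2009, App. C §11, Example 11.3.1–11.3.2] -/
theorem j_mem_cmJInvariants_of_hasCM_of_three_facts (hirr : irreducible_classPolynomial)
    (hh : mem_classNumberOneDiscrs_of_classNumber_eq_one) (h9 : singularModuli_classNumberOne) :
    j_mem_cmJInvariants_of_hasCM :=
  j_mem_cmJInvariants_of_hasCM_of_four_facts periodPair_hasCM_of_hasCM_holds hirr hh h9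

/-- **`finite_point_of_hasCM_of_L_one_ne_zero` from its four remaining leaves**: for an elliptic
curve `E/ℚ` with (geometric) complex multiplication and `L(E, 1) ≠ 0`, `E(ℚ)` is finite
(Coates–Wiles 1977, Thm. 1; Silverman *AEC* C.16.5.3) — assuming exactly the `𝔭`-divisibility
core of Coates–Wiles (`h1`), the table of maximal singular moduli (`h9`), the irreducibility of
the class equation (`hirr`) and Heegner–Baker–Stark for orders (`hh`).
[cite: CoatesWiles1977, Thm 1 (p. 223)] [cite: SilvermanAEC2009, App. C §16, Evidence C.16.5.3] -/
theorem finite_point_of_hasCM_of_L_one_ne_zero_of_four_leaves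
    (h1 : CoatesWiles1977_L_one_div_period_mem_prime) (h9 : singularModuli_classNumberOne)
    (hirr : irreducible_classPolynomial) (hh : mem_classNumberOneDiscrs_of_classNumber_eq_one) :
    finite_point_of_hasCM_of_L_one_ne_zero :=
  finite_point_of_hasCM_of_L_one_ne_zero_of_leaves h1 h9 periodPair_hasCM_of_hasCM_holds hirr hh

/-- The same with the table of singular moduli reduced to its two unproved rows
`j(𝓞_{−67}) = −5280³`, `j(𝓞_{−163}) = −640320³`: five explicit hypotheses in all.
[cite: CoatesWiles1977, Thm 1 (p. 223)] [cite: Cox2013, §12.C table (12.20)] -/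
theorem finite_point_of_hasCM_of_L_one_ne_zero_of_four_leaves_of_two
    (h1 : CoatesWiles1977_L_one_div_period_mem_prime)
    (h67 : (cmPeriodPair (-67)).j = -147197952000)
    (h163 : (cmPeriodPair (-163)).j = -262537412640768000)
    (hirr : irreducible_classPolynomial) (hh : mem_classNumberOneDiscrs_of_classNumber_eq_one) :
    finite_point_of_hasCM_of_L_one_ne_zero :=
  finite_point_of_hasCM_of_L_one_ne_zero_of_four_leaves h1
    (singularModuli_classNumberOne_of_two h67 h163) hirr hh

/-- The BSD rank formula `r_an(E) = rank E(ℚ)` (`= 0`) in the CM analytic-rank-zero case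
(`bsdRankFormula_of_hasCM_of_L_one_ne_zero`, bsd.S28) from the same four leaves.
[cite: CoatesWiles1977, Thm 1 (rank-zero consequence)] -/
theorem bsdRankFormula_of_hasCM_of_L_one_ne_zero_of_four_leaves
    (h1 : CoatesWiles1977_L_one_div_period_mem_prime) (h9 : singularModuli_classNumberOne)
    (hirr : irreducible_classPolynomial) (hh : mem_classNumberOneDiscrs_of_classNumber_eq_one) :
    bsdRankFormula_of_hasCM_of_L_one_ne_zero :=
  bsdRankFormula_of_hasCM_of_L_one_ne_zero_of_finite_point
    (finite_point_of_hasCM_of_L_one_ne_zero_of_four_leaves h1 h9 hirr hh)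

end Literature.NumberTheory.EllipticCurves

end
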